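import Summits.QuantumFields.YangMills.Theorems.AllWindowsColdBoxBoxHighLineTiltCum5SizesMuSet
import Summits.QuantumFields.YangMills.Theorems.AllWindowsColdBoxBoxHighLineTiltCum5SizesBeta

/-!
# U5-L3-concrete on the CUT set, CONCLUSION — `κ₅,t` over `μ_{D′}` with the `U`-slots DISCHARGED, and its β-letters form under (K2)′-type exponents only
# (planner ym-idea-2 g18's request 2026-08-30T00:01:53Z / ruling 00:19:54Z «CUT of record»; `ASSEMBLY-U5.md` §3 (D′)/(E′); LINE-20 U5 ⟨stmt-QuantumFields-24336⟩)

Width seat `ym-line-sfw-p2-w5` (prover-ym-line-sfw-p2-w5-g24-0).  Sequel of ✓`…TiltCum5SizesMuSet` (`abs_tiltCum5_muSet_le_of_sizes`: κ₅ over `μ_{D′}` modulo the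
three `U`-slots `E₀[1_{D′}(tiltU − b)^{2k}]`, `B` explicit).  Since `D′ ⊆ D = smallField H s` and the powers are EVEN, the slots over `D′` are dominated by the
slots over `D`, i.e. by this seat's ✓`gaussAvg_sfInd_mul_tiltU_sub_pow_two_four_six_le` — the only extra input is the integrability of `1_D·(tiltU − b)^n·gaussWeight`
(`tiltU` is bounded on `D` by w4's ✓`TiltSup.abs_tiltU_le_of ghostTaylor`):

* `integrable_sfInd_mul_tiltU_sub_pow_mul_gaussWeight`, `gaussAvg_indicator_mul_tiltU_sub_pow_le` (the monotone transfer `D′ ⊆ D`);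
* ★★ `abs_tiltCum5_muSet_le_of_tiltU` — for `H ≥ 1`, `β ≥ H⁴`, `0 < s ≤ 1`, `s·H² ≤ c₀`, measurable `D′ ⊆ smallField H s`, `0 ≤ B`, `sup_{D′}|tiltU| ≤ B`,
  `E₀[1_{D′}] ≥ 1/2`, all `x, y`, `t ∈ [0,1]`: `|κ₅,t| ≤ C·e^{4B}·(1+log H)^m·((1+log H)²/β² + s³/(β√β))·(√R₃ + √R₁√R₂ + R₁√R₁)`,
  `R_k = (H⁴/β)^k + (βH⁴s⁵)^{2k} + (H⁶s³)^{2k} + (H⁴s⁴)^{2k}` — NO window constraint (a), NO `12θ < 1`;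
* ★★ `abs_tiltCum5_muSet_le_dominant` — under `βH⁴s⁵, H⁶s³, H⁴s⁴ ≤ H²/√β`: `|κ₅,t| ≤ 14·C·e^{4B}·(1+log H)^m·((1+log H)²/β² + s³/(β√β))·H⁶/(β√β)`;
* ★★★ `exists_beta0_abs_tiltCum5_muSet_le` — β-LETTERS at `s = β^{−1/2+κ₃}` under the (K2)′-type exponents ONLY (`0 ≤ θ`, `0 < κ₃`, `4θ + 4κ₃ < 1`,
  `2θ + 5κ₃ < 1`; e.g. the exponent point of record `κ₃ = 1/8 − θ/4`, every `θ < 1/10`): `∃ C m, ∃ β₀ ≥ 1, ∀ β ≥ β₀, ∀ H, 1 ≤ H ≤ β^θ + 1, ∀ D′` measurable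
  `⊆ smallField H s`, `∀ B ≥ 0`, `sup_{D′}|tiltU| ≤ B → E₀[1_{D′}] ≥ 1/2 → ∀ x y, ∀ t ∈ [0,1],`
  `|κ₅,t over μ_{D′}| ≤ C·e^{4B}·(1+log H)^m·(((1+log H)²/β² + s³/(β√β))·(H⁶/(β√β)))` — the κ₅ = f‴ size `≍ (1+log H)^{m+2}H⁶β^{−7/2}` on the CUT set for the
  whole HIGH window; `B = 2` and `E₀[1_{D′}] ≥ 1/2` are w4's ✓`…TiltSupBoundsCubicCut` and the cut-mass budget of the assembler; the third-order step is w2 g33's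
  13u³′ over `μ_{D′}` applied to this `K`.

Tree only; no definitions; standard axioms.  HONEST LABEL: U5 prep, helper-grade; U5 ⟨24336⟩ UNSTAFFED/OPEN, ⟨24004⟩ OPEN; route AllWindowsColdBox DRAFT;
no crux, rung or summit is proved; **the Yang–Mills mass gap is NOT proved by this file; no summit is proved by a line.**
-/

set_option autoImplicit false

noncomputable section

open MeasureTheory Set Real
open Literature.Probability.LatticeModels (Site)

namespace Summit.QuantumFields.YangMills.Theorems.AllWindowsColdBoxBoxHighLine

namespace GaussNormalForm

variable {H : ℕ}

/-! ## §1 Integrability on `D` and the monotone transfer `D′ ⊆ D` -/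

/-- `1_D·(tiltU − b)^n·gaussWeight` is integrable (`D = smallField H s`, `H ≥ 1`, `β > 0`, `0 ≤ s ≤ 1`, `s·H² ≤ c₀`): `tiltU` is bounded on `D`
(✓`TiltSup.abs_tiltU_le_of ghostTaylor`). -/
theorem integrable_sfInd_mul_tiltU_sub_pow_mul_gaussWeight : ∃ c₀ : ℝ, 0 < c₀ ∧ ∀ H : ℕ, 1 ≤ H → ∀ β : ℝ, 0 < β → ∀ s : ℝ, 0 ≤ s → s ≤ 1 →
    s * (H : ℝ) ^ 2 ≤ c₀ → ∀ (b : ℝ) (n : ℕ), Integrable fun a : LandauFree H → E3 => sfInd H s a * (tiltU β H a - b) ^ n * gaussWeight β H a := by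
  obtain ⟨C, c₀, m, hc₀, hU⟩ := TiltSup.abs_tiltU_le_of ghostTaylor
  refine ⟨c₀, hc₀, fun H hH β hβ s hs0 hs1 hsH b n => ?_⟩
  obtain ⟨M, hM⟩ : ∃ M : ℝ, M = C * (1 + Real.log H) ^ m * (|β| * (H : ℝ) ^ 4 * s ^ 3 + (H : ℝ) ^ 6 * s ^ 2) := ⟨_, rfl⟩
  have hUM : ∀ a ∈ smallField H s, |tiltU β H a| ≤ M := fun a ha => by rw [hM]; exact hU H hH β s hs0 hs1 hsH a ha
  have hY : Measurable fun a : LandauFree H → E3 => sfInd H s a * (tiltU β H a - b) ^ n :=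
    (Tilt.measurable_sfInd H s).mul (((measurable_tiltU β H).sub measurable_const).pow_const n)
  have hYb : ∀ a, |sfInd H s a * (tiltU β H a - b) ^ n| ≤ (M + |b|) ^ n := by
    intro a
    by_cases ha : a ∈ smallField H s
    · rw [sfInd, Set.indicator_of_mem ha, one_mul, abs_pow]
      exact pow_le_pow_left₀ (abs_nonneg _) ((abs_sub _ _).trans (add_le_add (hUM a ha) le_rfl)) n
    · rw [sfInd, Set.indicator_of_notMem ha, zero_mul, abs_zero]
      exact pow_nonneg ((le_trans (abs_nonneg _) (hUM 0 (by intro e; simp [hs0]))).trans (le_add_of_nonneg_right (abs_nonneg b))) n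
  exact Tilt.integrable_bdd_mul_gaussWeight H hβ hY hYb

/-- **Monotone transfer `D′ ⊆ D`**: for `D′ ⊆ smallField H s` and even `n`, `E₀[1_{D′}·(tiltU − b)^n] ≤ E₀[1_D·(tiltU − b)^n]` (same `c₀`). -/
theorem gaussAvg_indicator_mul_tiltU_sub_pow_le : ∃ c₀ : ℝ, 0 < c₀ ∧ ∀ H : ℕ, 1 ≤ H → ∀ β : ℝ, 0 < β → ∀ s : ℝ, 0 ≤ s → s ≤ 1 →
    s * (H : ℝ) ^ 2 ≤ c₀ → ∀ D : Set (LandauFree H → E3), D ⊆ smallField H s → ∀ (b : ℝ) (n : ℕ), Even n →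
      gaussAvg β H (fun a => D.indicator (fun _ => (1 : ℝ)) a * (tiltU β H a - b) ^ n) ≤ gaussAvg β H (fun a => sfInd H s a * (tiltU β H a - b) ^ n) := by
  obtain ⟨c₀, hc₀, hI⟩ := integrable_sfInd_mul_tiltU_sub_pow_mul_gaussWeight
  refine ⟨c₀, hc₀, fun H hH β hβ s hs0 hs1 hsH D hDs b n hn => ?_⟩
  have hind : ∀ a, 0 ≤ D.indicator (fun _ => (1 : ℝ)) a ∧ D.indicator (fun _ => (1 : ℝ)) a ≤ sfInd H s a := by
    intro a
    by_cases ha : a ∈ D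
    · rw [Set.indicator_of_mem ha, sfInd, Set.indicator_of_mem (hDs ha)]; norm_num
    · rw [Set.indicator_of_notMem ha]; exact ⟨le_rfl, (TiltSup.sfInd_nonneg_le_one (H := H) s a).1⟩
  exact EdgeChartGaussian.gaussAvg_mono_of_nonneg H hβ (fun a => mul_nonneg (hind a).1 (hn.pow_nonneg _))
    (fun a => mul_le_mul_of_nonneg_right (hind a).2 (hn.pow_nonneg _)) (hI H hH β hβ s hs0 hs1 hsH b n)

/-! ## §2 `κ₅,t` over `μ_{D′}` with the `U`-slots discharged -/

/-- ★★ **`κ₅,t(c_x, c_y; tiltU)` over `μ_{D′}` with the `U`-slots DISCHARGED, `B` a hypothesis**: there are `C ≥ 0`, `m`, `c₀ > 0` such that for all `H ≥ 1`,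
`β ≥ H⁴`, `0 < s ≤ 1`, `s·H² ≤ c₀`, measurable `D′ ⊆ smallField H s`, `0 ≤ B`, `sup_{D′}|tiltU| ≤ B`, `E₀[1_{D′}] ≥ 1/2`, all `x, y`, `t ∈ [0,1]`:
`|κ₅,t| ≤ C·e^{4B}·(1+log H)^m·((1+log H)²/β² + s³/(β√β))·(√R₃ + √R₁·√R₂ + R₁·√R₁)`. -/
theorem abs_tiltCum5_muSet_le_of_tiltU : ∃ C : ℝ, ∃ m : ℕ, ∃ c₀ : ℝ, 0 < c₀ ∧ 0 ≤ C ∧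
    ∀ H : ℕ, 1 ≤ H → ∀ β : ℝ, (H : ℝ) ^ 4 ≤ β → ∀ s : ℝ, 0 < s → s ≤ 1 → s * (H : ℝ) ^ 2 ≤ c₀ →
    ∀ D : Set (LandauFree H → E3), MeasurableSet D → D ⊆ smallField H s → ∀ B : ℝ, 0 ≤ B →
    (∀ a ∈ D, |tiltU β H a| ≤ B) → 1 / 2 ≤ gaussAvg β H (D.indicator fun _ => (1 : ℝ)) →
    ∀ (x y : Site 4), ∀ t ∈ Set.Icc (0 : ℝ) 1,
      |Tilt.tiltCum5 (((volume : Measure (LandauFree H → E3)).restrict D).withDensity fun a => ENNReal.ofReal (gaussWeight β H a))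
          (tiltU β H) t (chartPlaqCost H x 1 2) (chartPlaqCost H y 1 2)| ≤
        C * Real.exp (4 * B) * (1 + Real.log H) ^ m * (((1 + Real.log H) ^ 2 / β ^ 2 + s ^ 3 / (β * Real.sqrt β)) *
          (Real.sqrt (((H : ℝ) ^ 4 / β) ^ 3 + (β * (H : ℝ) ^ 4 * s ^ 5) ^ 6 + ((H : ℝ) ^ 6 * s ^ 3) ^ 6 + ((H : ℝ) ^ 4 * s ^ 4) ^ 6) +
            Real.sqrt ((H : ℝ) ^ 4 / β + (β * (H : ℝ) ^ 4 * s ^ 5) ^ 2 + ((H : ℝ) ^ 6 * s ^ 3) ^ 2 + ((H : ℝ) ^ 4 * s ^ 4) ^ 2) *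
              Real.sqrt (((H : ℝ) ^ 4 / β) ^ 2 + (β * (H : ℝ) ^ 4 * s ^ 5) ^ 4 + ((H : ℝ) ^ 6 * s ^ 3) ^ 4 + ((H : ℝ) ^ 4 * s ^ 4) ^ 4) +
            ((H : ℝ) ^ 4 / β + (β * (H : ℝ) ^ 4 * s ^ 5) ^ 2 + ((H : ℝ) ^ 6 * s ^ 3) ^ 2 + ((H : ℝ) ^ 4 * s ^ 4) ^ 2) *
              Real.sqrt ((H : ℝ) ^ 4 / β + (β * (H : ℝ) ^ 4 * s ^ 5) ^ 2 + ((H : ℝ) ^ 6 * s ^ 3) ^ 2 + ((H : ℝ) ^ 4 * s ^ 4) ^ 2))) := by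
  obtain ⟨C₅, hC₅0, h5⟩ := abs_tiltCum5_muSet_le_of_sizes
  obtain ⟨CU, m, c₁, hc₁, hCU0, hU⟩ := gaussAvg_sfInd_mul_tiltU_sub_pow_two_four_six_le
  obtain ⟨c₂, hc₂, hT⟩ := gaussAvg_indicator_mul_tiltU_sub_pow_le
  refine ⟨C₅ * (1 + CU) ^ 2, 2 * m, min c₁ c₂, lt_min hc₁ hc₂, by positivity,
    fun H hH β hβ s hs0 hs1 hsH D hDm hDs B hB0 hUB hD x y t ht => ?_⟩
  have hsH1 : s * (H : ℝ) ^ 2 ≤ c₁ := hsH.trans (min_le_left _ _)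
  have hsH2 : s * (H : ℝ) ^ 2 ≤ c₂ := hsH.trans (min_le_right _ _)
  have hH1 : (1 : ℝ) ≤ H := by exact_mod_cast hH
  have hβ1 : 1 ≤ β := le_trans (one_le_pow₀ hH1) hβ
  have hβpos : 0 < β := lt_of_lt_of_le one_pos hβ1
  obtain ⟨b, hb2, hb4, hb6⟩ := hU H hH β hβ s hs0.le hs1 hsH1
  have hb2' := (hT H hH β hβpos s hs0.le hs1 hsH2 D hDs b 2 (by decide)).trans hb2
  have hb4' := (hT H hH β hβpos s hs0.le hs1 hsH2 D hDs b 4 (by decide)).trans hb4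
  have hb6' := (hT H hH β hβpos s hs0.le hs1 hsH2 D hDs b 6 (by decide)).trans hb6
  -- opaque abbreviations
  obtain ⟨L, hL⟩ : ∃ L : ℝ, L = 1 + Real.log (H : ℝ) := ⟨_, rfl⟩
  have hL1 : 1 ≤ L := by rw [hL]; have := Real.log_nonneg hH1; linarith
  have hL0 : 0 ≤ L := zero_le_one.trans hL1
  obtain ⟨R₁, hR₁⟩ : ∃ R : ℝ, R = (H : ℝ) ^ 4 / β + (β * (H : ℝ) ^ 4 * s ^ 5) ^ 2 + ((H : ℝ) ^ 6 * s ^ 3) ^ 2 + ((H : ℝ) ^ 4 * s ^ 4) ^ 2 := ⟨_, rfl⟩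
  obtain ⟨R₂, hR₂⟩ : ∃ R : ℝ, R = ((H : ℝ) ^ 4 / β) ^ 2 + (β * (H : ℝ) ^ 4 * s ^ 5) ^ 4 + ((H : ℝ) ^ 6 * s ^ 3) ^ 4 + ((H : ℝ) ^ 4 * s ^ 4) ^ 4 :=
    ⟨_, rfl⟩
  obtain ⟨R₃, hR₃⟩ : ∃ R : ℝ, R = ((H : ℝ) ^ 4 / β) ^ 3 + (β * (H : ℝ) ^ 4 * s ^ 5) ^ 6 + ((H : ℝ) ^ 6 * s ^ 3) ^ 6 + ((H : ℝ) ^ 4 * s ^ 4) ^ 6 :=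
    ⟨_, rfl⟩
  have hR₁0 : 0 ≤ R₁ := by rw [hR₁]; positivity
  obtain ⟨K, hK⟩ : ∃ K : ℝ, K = CU * L ^ m := ⟨_, rfl⟩
  have hK0 : 0 ≤ K := by rw [hK]; exact mul_nonneg hCU0 (pow_nonneg hL0 _)
  rw [← hL, ← hR₁] at hb2'
  rw [← hL, ← hR₂] at hb4'
  rw [← hL, ← hR₃] at hb6'
  rw [← hL, ← hR₁, ← hR₂, ← hR₃]
  rw [← hK] at hb2' hb4' hb6'
  have h := h5 H hH β hβ1 s hs0 hs1 D hDm hDs B hB0 hUB hD b (K * R₁) (K * R₂) (K * R₃) (mul_nonneg hK0 hR₁0)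
    (mul_nonneg hK0 (by rw [hR₂]; positivity)) (mul_nonneg hK0 (by rw [hR₃]; positivity)) hb2' hb4' hb6' x y t ht
  rw [← hL] at h
  have hA0 : 0 ≤ L ^ 2 / β ^ 2 := by positivity
  have hSg0 : 0 ≤ s ^ 3 / (β * Real.sqrt β) := by positivity
  have hcoll := k5_slots_collapse (R₂ := R₂) (R₃ := R₃) (a := L ^ 2 / β ^ 2 + s ^ 3 / (β * Real.sqrt β)) (c := L ^ 2 / β ^ 2) hK0
    (add_nonneg hA0 hSg0) hA0 hR₁0
  have hKL : (1 + K) ^ 2 ≤ (1 + CU) ^ 2 * L ^ (2 * m) := by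
    have hLm1 : 1 ≤ L ^ m := one_le_pow₀ hL1
    have h1 : 1 + K ≤ (1 + CU) * L ^ m := by rw [hK]; nlinarith only [hLm1, hCU0]
    calc (1 + K) ^ 2 ≤ ((1 + CU) * L ^ m) ^ 2 := pow_le_pow_left₀ (by linarith only [hK0]) h1 2
      _ = (1 + CU) ^ 2 * L ^ (2 * m) := by ring
  obtain ⟨u, hu⟩ : ∃ u : ℝ, u = Real.sqrt R₁ := ⟨_, rfl⟩
  obtain ⟨v, hv⟩ : ∃ v : ℝ, v = Real.sqrt R₂ := ⟨_, rfl⟩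
  obtain ⟨w, hw⟩ : ∃ w : ℝ, w = Real.sqrt R₃ := ⟨_, rfl⟩
  have hu0 : 0 ≤ u := by rw [hu]; exact Real.sqrt_nonneg _
  have hv0 : 0 ≤ v := by rw [hv]; exact Real.sqrt_nonneg _
  have hw0 : 0 ≤ w := by rw [hw]; exact Real.sqrt_nonneg _
  rw [← hu, ← hv, ← hw] at hcoll ⊢
  obtain ⟨a, ha⟩ : ∃ a : ℝ, a = L ^ 2 / β ^ 2 + s ^ 3 / (β * Real.sqrt β) := ⟨_, rfl⟩
  obtain ⟨c, hc⟩ : ∃ c : ℝ, c = L ^ 2 / β ^ 2 := ⟨_, rfl⟩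
  have ha0 : 0 ≤ a := by rw [ha]; exact add_nonneg hA0 hSg0
  have hca : c ≤ a := by rw [hc, ha]; exact le_add_of_nonneg_right hSg0
  rw [← ha] at h hcoll ⊢
  rw [← hc] at h hcoll
  obtain ⟨E, hE⟩ : ∃ E : ℝ, E = Real.exp (4 * B) := ⟨_, rfl⟩
  have hE0 : 0 ≤ E := by rw [hE]; exact (Real.exp_pos _).le
  rw [← hE] at h ⊢
  have hB0' : 0 ≤ a * w + c * (u * v) + a * (R₁ * u) := by
    have hc0 : 0 ≤ c := by rw [hc]; exact hA0
    positivity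
  have hx : c * (u * v) ≤ a * (u * v) := mul_le_mul_of_nonneg_right hca (mul_nonneg hu0 hv0)
  have hCE : 0 ≤ C₅ * E := mul_nonneg hC₅0 hE0
  calc |Tilt.tiltCum5 (((volume : Measure (LandauFree H → E3)).restrict D).withDensity fun a => ENNReal.ofReal (gaussWeight β H a))
          (tiltU β H) t (chartPlaqCost H x 1 2) (chartPlaqCost H y 1 2)|
      ≤ C₅ * E * (a * Real.sqrt (K * R₃) + c * (Real.sqrt (K * R₁) * Real.sqrt (K * R₂)) + a * (K * R₁ * Real.sqrt (K * R₁))) := h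
    _ ≤ C₅ * E * ((1 + K) ^ 2 * (a * w + c * (u * v) + a * (R₁ * u))) := mul_le_mul_of_nonneg_left hcoll hCE
    _ ≤ C₅ * E * ((1 + CU) ^ 2 * L ^ (2 * m) * (a * w + c * (u * v) + a * (R₁ * u))) :=
        mul_le_mul_of_nonneg_left (mul_le_mul_of_nonneg_right hKL hB0') hCE
    _ ≤ C₅ * E * ((1 + CU) ^ 2 * L ^ (2 * m) * (a * (w + u * v + R₁ * u))) := by
        have hc0' : 0 ≤ (1 + CU) ^ 2 * L ^ (2 * m) := by positivity
        have : a * w + c * (u * v) + a * (R₁ * u) ≤ a * (w + u * v + R₁ * u) := by nlinarith only [hx]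
        exact mul_le_mul_of_nonneg_left (mul_le_mul_of_nonneg_left this hc0') hCE
    _ = C₅ * (1 + CU) ^ 2 * E * L ^ (2 * m) * (a * (w + u * v + R₁ * u)) := by ring

/-- ★★ **`κ₅,t` over `μ_{D′}` in the DOMINANT regime** (`βH⁴s⁵, H⁶s³, H⁴s⁴ ≤ H²/√β`):
`|κ₅,t| ≤ 14·C·e^{4B}·(1+log H)^m·((1+log H)²/β² + s³/(β√β))·H⁶/(β√β)`. -/
theorem abs_tiltCum5_muSet_le_dominant : ∃ C : ℝ, ∃ m : ℕ, ∃ c₀ : ℝ, 0 < c₀ ∧ 0 ≤ C ∧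
    ∀ H : ℕ, 1 ≤ H → ∀ β : ℝ, (H : ℝ) ^ 4 ≤ β → ∀ s : ℝ, 0 < s → s ≤ 1 → s * (H : ℝ) ^ 2 ≤ c₀ →
    β * (H : ℝ) ^ 4 * s ^ 5 ≤ (H : ℝ) ^ 2 / Real.sqrt β → (H : ℝ) ^ 6 * s ^ 3 ≤ (H : ℝ) ^ 2 / Real.sqrt β → (H : ℝ) ^ 4 * s ^ 4 ≤ (H : ℝ) ^ 2 / Real.sqrt β →
    ∀ D : Set (LandauFree H → E3), MeasurableSet D → D ⊆ smallField H s → ∀ B : ℝ, 0 ≤ B →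
    (∀ a ∈ D, |tiltU β H a| ≤ B) → 1 / 2 ≤ gaussAvg β H (D.indicator fun _ => (1 : ℝ)) →
    ∀ (x y : Site 4), ∀ t ∈ Set.Icc (0 : ℝ) 1,
      |Tilt.tiltCum5 (((volume : Measure (LandauFree H → E3)).restrict D).withDensity fun a => ENNReal.ofReal (gaussWeight β H a))
          (tiltU β H) t (chartPlaqCost H x 1 2) (chartPlaqCost H y 1 2)| ≤
        14 * C * Real.exp (4 * B) * (1 + Real.log H) ^ m * (((1 + Real.log H) ^ 2 / β ^ 2 + s ^ 3 / (β * Real.sqrt β)) * ((H : ℝ) ^ 6 / (β * Real.sqrt β))) := by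
  obtain ⟨C, m, c₀, hc₀, hC0, h⟩ := abs_tiltCum5_muSet_le_of_tiltU
  refine ⟨C, m, c₀, hc₀, hC0, fun H hH β hβ s hs0 hs1 hsH hd1 hd2 hd3 D hDm hDs B hB0 hUB hD x y t ht => ?_⟩
  have hH1 : (1 : ℝ) ≤ H := by exact_mod_cast hH
  have hβ1 : 1 ≤ β := le_trans (one_le_pow₀ hH1) hβ
  have hβpos : 0 < β := lt_of_lt_of_le one_pos hβ1
  have hh := h H hH β hβ s hs0 hs1 hsH D hDm hDs B hB0 hUB hD x y t ht
  obtain ⟨ρ, hρ⟩ : ∃ r : ℝ, r = (H : ℝ) ^ 2 / Real.sqrt β := ⟨_, rfl⟩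
  have hρ0 : 0 ≤ ρ := by rw [hρ]; positivity
  have hρ2 : (H : ℝ) ^ 4 / β = ρ ^ 2 := by
    rw [hρ, div_pow, Real.sq_sqrt hβpos.le]; ring
  have hρ3 : (H : ℝ) ^ 6 / (β * Real.sqrt β) = ρ ^ 3 := by
    have e3 : Real.sqrt β ^ 3 = β * Real.sqrt β := by
      rw [pow_succ, Real.sq_sqrt hβpos.le]
    rw [hρ, div_pow, e3]; ring
  rw [← hρ] at hd1 hd2 hd3
  have hb1 : 0 ≤ β * (H : ℝ) ^ 4 * s ^ 5 := by positivity
  have hb2 : 0 ≤ (H : ℝ) ^ 6 * s ^ 3 := by positivity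
  have hb3 : 0 ≤ (H : ℝ) ^ 4 * s ^ 4 := by positivity
  have hRle : ∀ k : ℕ, ((H : ℝ) ^ 4 / β) ^ k + (β * (H : ℝ) ^ 4 * s ^ 5) ^ (2 * k) + ((H : ℝ) ^ 6 * s ^ 3) ^ (2 * k) +
      ((H : ℝ) ^ 4 * s ^ 4) ^ (2 * k) ≤ 4 * (ρ ^ 2) ^ k := by
    intro k
    have t1 : (β * (H : ℝ) ^ 4 * s ^ 5) ^ (2 * k) ≤ (ρ ^ 2) ^ k := by
      rw [pow_mul]; exact pow_le_pow_left₀ (sq_nonneg _) (pow_le_pow_left₀ hb1 hd1 2) k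
    have t2 : ((H : ℝ) ^ 6 * s ^ 3) ^ (2 * k) ≤ (ρ ^ 2) ^ k := by
      rw [pow_mul]; exact pow_le_pow_left₀ (sq_nonneg _) (pow_le_pow_left₀ hb2 hd2 2) k
    have t3 : ((H : ℝ) ^ 4 * s ^ 4) ^ (2 * k) ≤ (ρ ^ 2) ^ k := by
      rw [pow_mul]; exact pow_le_pow_left₀ (sq_nonneg _) (pow_le_pow_left₀ hb3 hd3 2) k
    rw [hρ2]
    linarith only [t1, t2, t3]
  have hR1 : (H : ℝ) ^ 4 / β + (β * (H : ℝ) ^ 4 * s ^ 5) ^ 2 + ((H : ℝ) ^ 6 * s ^ 3) ^ 2 + ((H : ℝ) ^ 4 * s ^ 4) ^ 2 ≤ 4 * ρ ^ 2 := by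
    simpa only [Nat.mul_one, pow_one] using hRle 1
  have hR2 : ((H : ℝ) ^ 4 / β) ^ 2 + (β * (H : ℝ) ^ 4 * s ^ 5) ^ 4 + ((H : ℝ) ^ 6 * s ^ 3) ^ 4 + ((H : ℝ) ^ 4 * s ^ 4) ^ 4 ≤ 4 * (ρ ^ 2) ^ 2 := by
    simpa only [show 2 * 2 = 4 from rfl] using hRle 2
  have hR3 : ((H : ℝ) ^ 4 / β) ^ 3 + (β * (H : ℝ) ^ 4 * s ^ 5) ^ 6 + ((H : ℝ) ^ 6 * s ^ 3) ^ 6 + ((H : ℝ) ^ 4 * s ^ 4) ^ 6 ≤ 4 * (ρ ^ 2) ^ 3 := by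
    simpa only [show 2 * 3 = 6 from rfl] using hRle 3
  obtain ⟨R₁, hR₁⟩ : ∃ R : ℝ, R = (H : ℝ) ^ 4 / β + (β * (H : ℝ) ^ 4 * s ^ 5) ^ 2 + ((H : ℝ) ^ 6 * s ^ 3) ^ 2 + ((H : ℝ) ^ 4 * s ^ 4) ^ 2 := ⟨_, rfl⟩
  obtain ⟨R₂, hR₂⟩ : ∃ R : ℝ, R = ((H : ℝ) ^ 4 / β) ^ 2 + (β * (H : ℝ) ^ 4 * s ^ 5) ^ 4 + ((H : ℝ) ^ 6 * s ^ 3) ^ 4 + ((H : ℝ) ^ 4 * s ^ 4) ^ 4 :=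
    ⟨_, rfl⟩
  obtain ⟨R₃, hR₃⟩ : ∃ R : ℝ, R = ((H : ℝ) ^ 4 / β) ^ 3 + (β * (H : ℝ) ^ 4 * s ^ 5) ^ 6 + ((H : ℝ) ^ 6 * s ^ 3) ^ 6 + ((H : ℝ) ^ 4 * s ^ 4) ^ 6 :=
    ⟨_, rfl⟩
  rw [← hR₁] at hR1
  rw [← hR₂] at hR2
  rw [← hR₃] at hR3
  rw [← hR₁, ← hR₂, ← hR₃] at hh
  have hs1' : Real.sqrt R₁ ≤ 2 * ρ := Real.sqrt_le_iff.mpr ⟨by positivity, by nlinarith only [hR1]⟩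
  have hs2' : Real.sqrt R₂ ≤ 2 * ρ ^ 2 := Real.sqrt_le_iff.mpr ⟨by positivity, by nlinarith only [hR2]⟩
  have hs3' : Real.sqrt R₃ ≤ 2 * ρ ^ 3 := Real.sqrt_le_iff.mpr ⟨by positivity, by nlinarith only [hR3]⟩
  have hsum : Real.sqrt R₃ + Real.sqrt R₁ * Real.sqrt R₂ + R₁ * Real.sqrt R₁ ≤ 14 * ρ ^ 3 := by
    have p1 : Real.sqrt R₁ * Real.sqrt R₂ ≤ (2 * ρ) * (2 * ρ ^ 2) := mul_le_mul hs1' hs2' (Real.sqrt_nonneg _) (by positivity)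
    have p2 : R₁ * Real.sqrt R₁ ≤ (4 * ρ ^ 2) * (2 * ρ) := mul_le_mul hR1 hs1' (Real.sqrt_nonneg _) (by positivity)
    have e : (2 * ρ) * (2 * ρ ^ 2) = 4 * ρ ^ 3 := by ring
    have e' : (4 * ρ ^ 2) * (2 * ρ) = 8 * ρ ^ 3 := by ring
    rw [e] at p1
    rw [e'] at p2
    linarith only [p1, p2, hs3']
  have hpre : 0 ≤ C * Real.exp (4 * B) * (1 + Real.log (H : ℝ)) ^ m * ((1 + Real.log (H : ℝ)) ^ 2 / β ^ 2 + s ^ 3 / (β * Real.sqrt β)) := by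
    have := Real.log_nonneg hH1
    positivity
  calc |Tilt.tiltCum5 (((volume : Measure (LandauFree H → E3)).restrict D).withDensity fun a => ENNReal.ofReal (gaussWeight β H a))
          (tiltU β H) t (chartPlaqCost H x 1 2) (chartPlaqCost H y 1 2)|
      ≤ C * Real.exp (4 * B) * (1 + Real.log (H : ℝ)) ^ m * (((1 + Real.log (H : ℝ)) ^ 2 / β ^ 2 + s ^ 3 / (β * Real.sqrt β)) *
          (Real.sqrt R₃ + Real.sqrt R₁ * Real.sqrt R₂ + R₁ * Real.sqrt R₁)) := hh
    _ = C * Real.exp (4 * B) * (1 + Real.log (H : ℝ)) ^ m * ((1 + Real.log (H : ℝ)) ^ 2 / β ^ 2 + s ^ 3 / (β * Real.sqrt β)) *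
          (Real.sqrt R₃ + Real.sqrt R₁ * Real.sqrt R₂ + R₁ * Real.sqrt R₁) := by ring
    _ ≤ C * Real.exp (4 * B) * (1 + Real.log (H : ℝ)) ^ m * ((1 + Real.log (H : ℝ)) ^ 2 / β ^ 2 + s ^ 3 / (β * Real.sqrt β)) * (14 * ρ ^ 3) :=
        mul_le_mul_of_nonneg_left hsum hpre
    _ = 14 * C * Real.exp (4 * B) * (1 + Real.log (H : ℝ)) ^ m *
          (((1 + Real.log (H : ℝ)) ^ 2 / β ^ 2 + s ^ 3 / (β * Real.sqrt β)) * ((H : ℝ) ^ 6 / (β * Real.sqrt β))) := by rw [hρ3]; ring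

/-! ## §3 β-letters on the cut set, (K2)′-type exponents only -/

/-- ★★★ **`κ₅,t` over `μ_{D′}` in β-letters, `B` and the cut mass as hypotheses, NO window constraint (a)**: for `0 ≤ θ`, `0 < κ₃`, `4θ + 4κ₃ < 1`,
`2θ + 5κ₃ < 1` there are `C ≥ 0`, `m`, `β₀ ≥ 1` such that for all `β ≥ β₀`, `1 ≤ H ≤ β^θ + 1`, every measurable `D′ ⊆ smallField H (β^{−1/2+κ₃})`, every
`B ≥ 0` with `sup_{D′}|tiltU β H| ≤ B` and `E₀[1_{D′}] ≥ 1/2`, all `x, y`, `t ∈ [0,1]` (`s = β^{−1/2+κ₃}`):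
`|κ₅,t over μ_{D′}| ≤ C·e^{4B}·(1+log H)^m·(((1+log H)²/β² + s³/(β√β))·(H⁶/(β√β)))`. -/
theorem exists_beta0_abs_tiltCum5_muSet_le {θ κ₃ : ℝ} (hθ : 0 ≤ θ) (hκ0 : 0 < κ₃) (h44 : 4 * θ + 4 * κ₃ < 1) (h25 : 2 * θ + 5 * κ₃ < 1) :
    ∃ C : ℝ, ∃ m : ℕ, 0 ≤ C ∧ ∃ β₀ : ℝ, 1 ≤ β₀ ∧ ∀ β : ℝ, β₀ ≤ β → ∀ H : ℕ, 1 ≤ H → (H : ℝ) ≤ β ^ θ + 1 →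
      ∀ D : Set (LandauFree H → E3), MeasurableSet D → D ⊆ smallField H (β ^ (-1 / 2 + κ₃)) → ∀ B : ℝ, 0 ≤ B →
      (∀ a ∈ D, |tiltU β H a| ≤ B) → 1 / 2 ≤ gaussAvg β H (D.indicator fun _ => (1 : ℝ)) →
      ∀ (x y : Site 4), ∀ t ∈ Set.Icc (0 : ℝ) 1,
        |Tilt.tiltCum5 (((volume : Measure (LandauFree H → E3)).restrict D).withDensity fun a => ENNReal.ofReal (gaussWeight β H a))
            (tiltU β H) t (chartPlaqCost H x 1 2) (chartPlaqCost H y 1 2)| ≤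
          C * Real.exp (4 * B) * (1 + Real.log H) ^ m *
            (((1 + Real.log H) ^ 2 / β ^ 2 + (β ^ (-1 / 2 + κ₃)) ^ 3 / (β * Real.sqrt β)) * ((H : ℝ) ^ 6 / (β * Real.sqrt β))) := by
  obtain ⟨C, m, c₀, hc₀, hC0, hK⟩ := abs_tiltCum5_muSet_le_dominant
  obtain ⟨b₁, hb₁1, hb₁⟩ := ErrorBudget.exists_forall_natPow_log_le (k := 4) (γ := 1) hθ (by push_cast; linarith) one_pos 1 0 0
  obtain ⟨b₂, hb₂1, hb₂⟩ := ErrorBudget.exists_forall_natPow_log_le (k := 2) (γ := 1 / 2 - κ₃) hθ (by push_cast; linarith) hc₀ 1 0 0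
  obtain ⟨b₃, hb₃1, hb₃⟩ := ErrorBudget.exists_forall_natPow_log_le (k := 2) (γ := 1 - 5 * κ₃) hθ (by push_cast; linarith) one_pos 1 0 0
  obtain ⟨b₄, hb₄1, hb₄⟩ := ErrorBudget.exists_forall_natPow_log_le (k := 4) (γ := 1 - 3 * κ₃) hθ (by push_cast; linarith) one_pos 1 0 0
  obtain ⟨b₅, hb₅1, hb₅⟩ := ErrorBudget.exists_forall_natPow_log_le (k := 2) (γ := 3 / 2 - 4 * κ₃) hθ (by push_cast; linarith) one_pos 1 0 0
  refine ⟨14 * C, m, by positivity, max (max (max b₁ b₂) (max b₃ b₄)) b₅, le_max_of_le_left (le_max_of_le_left (le_max_of_le_left hb₁1)),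
    fun β hβ H hH hHu D hDm hDs B hB0 hUB hD x y t ht => ?_⟩
  simp only [max_le_iff] at hβ
  obtain ⟨⟨⟨hβ1, hβ2⟩, hβ3, hβ4⟩, hβ5⟩ := hβ
  have hβone : 1 ≤ β := hb₁1.trans hβ1
  have hβ0 : 0 < β := lt_of_lt_of_le one_pos hβone
  have hH1 : (1 : ℝ) ≤ H := by exact_mod_cast hH
  set s : ℝ := β ^ (-1 / 2 + κ₃) with hs
  have hs0 : 0 < s := Real.rpow_pos_of_pos hβ0 _
  have hs1 : s ≤ 1 := TiltSup.rpow_neg_half_add_le_one hβone (by linarith)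
  have h1 := hb₁ β hβ1 H hH hHu
  simp only [pow_zero, mul_one, one_mul, Real.rpow_one] at h1
  have hH4 : (H : ℝ) ^ 4 ≤ β := by rwa [div_le_one hβ0] at h1
  have h2 := hb₂ β hβ2 H hH hHu
  simp only [pow_zero, mul_one, one_mul] at h2
  have hsH : s * (H : ℝ) ^ 2 ≤ c₀ := by
    rw [hs, TiltSup.rpow_eq_one_div hβ0, one_div_mul_eq_div]; exact h2
  have h3 := hb₃ β hβ3 H hH hHu
  have h4 := hb₄ β hβ4 H hH hHu
  have h5 := hb₅ β hβ5 H hH hHu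
  simp only [pow_zero, mul_one, one_mul] at h3 h4 h5
  have hP3 : (H : ℝ) ^ 2 ≤ β ^ (1 - 5 * κ₃) := by rwa [div_le_one (Real.rpow_pos_of_pos hβ0 _)] at h3
  have hP4 : (H : ℝ) ^ 4 ≤ β ^ (1 - 3 * κ₃) := by rwa [div_le_one (Real.rpow_pos_of_pos hβ0 _)] at h4
  have hP5 : (H : ℝ) ^ 2 ≤ β ^ (3 / 2 - 4 * κ₃) := by rwa [div_le_one (Real.rpow_pos_of_pos hβ0 _)] at h5
  have hsq : (H : ℝ) ^ 2 / Real.sqrt β = (H : ℝ) ^ 2 * (Real.sqrt β)⁻¹ := div_eq_mul_inv _ _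
  have hd1 : β * (H : ℝ) ^ 4 * s ^ 5 ≤ (H : ℝ) ^ 2 / Real.sqrt β := by
    have e : β ^ (1 - 5 * κ₃) * (β * s ^ 5) = (Real.sqrt β)⁻¹ := by
      rw [← mul_assoc, ← Real.rpow_add_one hβ0.ne', hs]
      exact TiltSup.rpow_window_aux hβ0 5 (by push_cast; ring)
    calc β * (H : ℝ) ^ 4 * s ^ 5 = (H : ℝ) ^ 2 * ((H : ℝ) ^ 2 * (β * s ^ 5)) := by ring
      _ ≤ (H : ℝ) ^ 2 * (β ^ (1 - 5 * κ₃) * (β * s ^ 5)) :=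
          mul_le_mul_of_nonneg_left (mul_le_mul_of_nonneg_right hP3 (by positivity)) (by positivity)
      _ = (H : ℝ) ^ 2 / Real.sqrt β := by rw [e, hsq]
  have hd2 : (H : ℝ) ^ 6 * s ^ 3 ≤ (H : ℝ) ^ 2 / Real.sqrt β := by
    have e : β ^ (1 - 3 * κ₃) * s ^ 3 = (Real.sqrt β)⁻¹ := by
      rw [hs]; exact TiltSup.rpow_window_aux hβ0 3 (by push_cast; ring)
    calc (H : ℝ) ^ 6 * s ^ 3 = (H : ℝ) ^ 2 * ((H : ℝ) ^ 4 * s ^ 3) := by ring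
      _ ≤ (H : ℝ) ^ 2 * (β ^ (1 - 3 * κ₃) * s ^ 3) :=
          mul_le_mul_of_nonneg_left (mul_le_mul_of_nonneg_right hP4 (by positivity)) (by positivity)
      _ = (H : ℝ) ^ 2 / Real.sqrt β := by rw [e, hsq]
  have hd3 : (H : ℝ) ^ 4 * s ^ 4 ≤ (H : ℝ) ^ 2 / Real.sqrt β := by
    have e : β ^ (3 / 2 - 4 * κ₃) * s ^ 4 = (Real.sqrt β)⁻¹ := by
      rw [hs]; exact TiltSup.rpow_window_aux hβ0 4 (by push_cast; ring)
    calc (H : ℝ) ^ 4 * s ^ 4 = (H : ℝ) ^ 2 * ((H : ℝ) ^ 2 * s ^ 4) := by ring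
      _ ≤ (H : ℝ) ^ 2 * (β ^ (3 / 2 - 4 * κ₃) * s ^ 4) :=
          mul_le_mul_of_nonneg_left (mul_le_mul_of_nonneg_right hP5 (by positivity)) (by positivity)
      _ = (H : ℝ) ^ 2 / Real.sqrt β := by rw [e, hsq]
  have h := hK H hH β hH4 s hs0 hs1 hsH hd1 hd2 hd3 D hDm hDs B hB0 hUB hD x y t ht
  calc _ ≤ _ := h
    _ = 14 * C * Real.exp (4 * B) * (1 + Real.log H) ^ m *
          (((1 + Real.log H) ^ 2 / β ^ 2 + s ^ 3 / (β * Real.sqrt β)) * ((H : ℝ) ^ 6 / (β * Real.sqrt β))) := by ring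


/-! ## §4 The same two statements with the MASS-DEFECT slot `τ` (planner ym-idea-2 g18's binder shape 2026-08-30T00:34:10Z) — appended -/

/-- ★★ `abs_tiltCum5_muSet_le_of_tiltU` with the binders `(τ) (hτD : E₀[1 − 1_{D′}] ≤ τ) (hτ2 : τ ≤ 1/2)` in place of `E₀[1_{D′}] ≥ 1/2`
(✓`GaussRestrict.half_le_gaussAvg_indicator`; the κ₅ SIZE itself has no `√τ` summand — it is a bound, not a transfer). -/
theorem abs_tiltCum5_muSet_le_of_tiltU_tau : ∃ C : ℝ, ∃ m : ℕ, ∃ c₀ : ℝ, 0 < c₀ ∧ 0 ≤ C ∧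
    ∀ H : ℕ, 1 ≤ H → ∀ β : ℝ, (H : ℝ) ^ 4 ≤ β → ∀ s : ℝ, 0 < s → s ≤ 1 → s * (H : ℝ) ^ 2 ≤ c₀ →
    ∀ D : Set (LandauFree H → E3), MeasurableSet D → D ⊆ smallField H s → ∀ B : ℝ, 0 ≤ B → (∀ a ∈ D, |tiltU β H a| ≤ B) →
    ∀ τ : ℝ, gaussAvg β H (fun a => 1 - D.indicator (fun _ => (1 : ℝ)) a) ≤ τ → τ ≤ 1 / 2 →
    ∀ (x y : Site 4), ∀ t ∈ Set.Icc (0 : ℝ) 1,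
      |Tilt.tiltCum5 (((volume : Measure (LandauFree H → E3)).restrict D).withDensity fun a => ENNReal.ofReal (gaussWeight β H a))
          (tiltU β H) t (chartPlaqCost H x 1 2) (chartPlaqCost H y 1 2)| ≤
        C * Real.exp (4 * B) * (1 + Real.log H) ^ m * (((1 + Real.log H) ^ 2 / β ^ 2 + s ^ 3 / (β * Real.sqrt β)) *
          (Real.sqrt (((H : ℝ) ^ 4 / β) ^ 3 + (β * (H : ℝ) ^ 4 * s ^ 5) ^ 6 + ((H : ℝ) ^ 6 * s ^ 3) ^ 6 + ((H : ℝ) ^ 4 * s ^ 4) ^ 6) +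
            Real.sqrt ((H : ℝ) ^ 4 / β + (β * (H : ℝ) ^ 4 * s ^ 5) ^ 2 + ((H : ℝ) ^ 6 * s ^ 3) ^ 2 + ((H : ℝ) ^ 4 * s ^ 4) ^ 2) *
              Real.sqrt (((H : ℝ) ^ 4 / β) ^ 2 + (β * (H : ℝ) ^ 4 * s ^ 5) ^ 4 + ((H : ℝ) ^ 6 * s ^ 3) ^ 4 + ((H : ℝ) ^ 4 * s ^ 4) ^ 4) +
            ((H : ℝ) ^ 4 / β + (β * (H : ℝ) ^ 4 * s ^ 5) ^ 2 + ((H : ℝ) ^ 6 * s ^ 3) ^ 2 + ((H : ℝ) ^ 4 * s ^ 4) ^ 2) *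
              Real.sqrt ((H : ℝ) ^ 4 / β + (β * (H : ℝ) ^ 4 * s ^ 5) ^ 2 + ((H : ℝ) ^ 6 * s ^ 3) ^ 2 + ((H : ℝ) ^ 4 * s ^ 4) ^ 2))) := by
  obtain ⟨C, m, c₀, hc₀, hC0, h⟩ := abs_tiltCum5_muSet_le_of_tiltU
  refine ⟨C, m, c₀, hc₀, hC0, fun H hH β hβ s hs0 hs1 hsH D hDm hDs B hB0 hUB τ hτ hτ2 x y t ht => ?_⟩
  have hH1 : (1 : ℝ) ≤ H := by exact_mod_cast hH
  have hβpos : 0 < β := lt_of_lt_of_le one_pos (le_trans (one_le_pow₀ hH1) hβ)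
  exact h H hH β hβ s hs0 hs1 hsH D hDm hDs B hB0 hUB (GaussRestrict.half_le_gaussAvg_indicator hβpos hDm hτ hτ2) x y t ht

/-- ★★★ `exists_beta0_abs_tiltCum5_muSet_le` with the binders `(τ) (hτD : E₀[1 − 1_{D′}] ≤ τ) (hτ2 : τ ≤ 1/2)` in place of `E₀[1_{D′}] ≥ 1/2`. -/
theorem exists_beta0_abs_tiltCum5_muSet_le_tau {θ κ₃ : ℝ} (hθ : 0 ≤ θ) (hκ0 : 0 < κ₃) (h44 : 4 * θ + 4 * κ₃ < 1) (h25 : 2 * θ + 5 * κ₃ < 1) :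
    ∃ C : ℝ, ∃ m : ℕ, 0 ≤ C ∧ ∃ β₀ : ℝ, 1 ≤ β₀ ∧ ∀ β : ℝ, β₀ ≤ β → ∀ H : ℕ, 1 ≤ H → (H : ℝ) ≤ β ^ θ + 1 →
      ∀ D : Set (LandauFree H → E3), MeasurableSet D → D ⊆ smallField H (β ^ (-1 / 2 + κ₃)) → ∀ B : ℝ, 0 ≤ B →
      (∀ a ∈ D, |tiltU β H a| ≤ B) → ∀ τ : ℝ, gaussAvg β H (fun a => 1 - D.indicator (fun _ => (1 : ℝ)) a) ≤ τ → τ ≤ 1 / 2 →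
      ∀ (x y : Site 4), ∀ t ∈ Set.Icc (0 : ℝ) 1,
        |Tilt.tiltCum5 (((volume : Measure (LandauFree H → E3)).restrict D).withDensity fun a => ENNReal.ofReal (gaussWeight β H a))
            (tiltU β H) t (chartPlaqCost H x 1 2) (chartPlaqCost H y 1 2)| ≤
          C * Real.exp (4 * B) * (1 + Real.log H) ^ m *
            (((1 + Real.log H) ^ 2 / β ^ 2 + (β ^ (-1 / 2 + κ₃)) ^ 3 / (β * Real.sqrt β)) * ((H : ℝ) ^ 6 / (β * Real.sqrt β))) := by
  obtain ⟨C, m, hC0, β₀, hβ₀, h⟩ := exists_beta0_abs_tiltCum5_muSet_le hθ hκ0 h44 h25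
  refine ⟨C, m, hC0, β₀, hβ₀, fun β hβ H hH hHu D hDm hDs B hB0 hUB τ hτ hτ2 x y t ht => ?_⟩
  have hβpos : 0 < β := lt_of_lt_of_le one_pos (hβ₀.trans hβ)
  exact h β hβ H hH hHu D hDm hDs B hB0 hUB (GaussRestrict.half_le_gaussAvg_indicator hβpos hDm hτ hτ2) x y t ht

end GaussNormalForm

end Summit.QuantumFields.YangMills.Theorems.AllWindowsColdBoxBoxHighLine

end
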